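import Literature.AnabelianGeometry.EtaleTheta.Discharge.Sec4Prop42SubUnitRoots
import Literature.AnabelianGeometry.EtaleTheta.Discharge.Sec4Prop42SubIII
import Literature.AnabelianGeometry.EtaleTheta.Discharge.Sec4Prop42SubRefinement
import Literature.AnabelianGeometry.EtaleTheta.Discharge.Sec3Thm37Holds
import HarnessLib

/-!
# [EtTh] Proposition 4.2 (iii)/(iv) sub-DAG `Prop42Sub`: the structural laws `hBg`, `hΦd` discharged

Mochizuki, *The étale theta function and its Frobenioid-theoretic manifestations*, Publ. RIMS **45**
(2009) [EtTh], §4, Proposition 4.2, statement PDF pp. 88–89, proof pp. 89–90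
[cite: MochizukiEtTh2009, Prop 4.2 p.88].

PROOF-ONLY companion (abc-iut cell, FACT-LIST rows F-2793 `SaturatedRefinement`, F-2795
`RootFractionPair`, F-2797 `RootSquares`, F-2798 `UnitRootsUpstairs`, F-2799 `ZetaA`, F-2800 `ZetaB`,
F-2801 `BetaCompat`, F-2802 `ZetaB_unique`, F-2803 `ZetaA_unique_upto_mu`, F-2804 `RootUnitTorsion` of
`Literature/AnabelianGeometry/EtaleTheta/Prop42Sub.lean`; the typed node `BiKummerSetting.Prop42_iv`).
The conditional theorems of record (`Discharge/Sec4Prop42Sub.lean`, `…SubZetaA.lean`, `…SubUnitRoots.lean`,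
`…SubIII.lean`, `…SubRefinement.lean`, `…SubRootPair.lean`) carry two STRUCTURAL laws of the §3 tempered
Frobenioid `S.tf` as named hypotheses:

* `hBg : Objectwise IsGroupLike S.tf.ratFnFunctor` — "`B₀ ⊆ K^×` is a group-like monoid" (Def. 3.3 (iii) /
  Def. 3.6 (i), p. 77): since `TemperedFrobenioid.lean` v2 this is RECORDED by the field
  `RealifiedDivisorMonoids.isUnit_BΛ` and PROVED for every tempered Frobenioid as
  `TemperedFrobenioid.ratFnFunctor_isGroupLike_holds` (`Discharge/Sec3Thm37Holds.lean`);
* `hΦd : Objectwise IsDivisorial S.tf.divisorMonoid` — "`Φ` … a divisorial monoid on `D`" (Def. 3.6 (ii),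
  p. 77, [FrdI] Def. 1.1): a FIELD of the structure (`isDivisorialOn`) read through the [FrdI]-vocabulary
  parameter `VD`; at the canonical vocabulary `VD := treeCatVocab D _ _` (`FrdIVocabulary.lean`) it IS the
  tree's notion and is PROVED as `TemperedFrobenioid.isDivisorial_divisorMonoid`
  (`Discharge/Sec3Thm37SubQFT.lean`).

§A removes `hBg` everywhere (arbitrary vocabulary `VD`).  §B works at the canonical vocabulary and removes
BOTH laws: the sub-nodes L08 `BetaCompat`, U1 `ZetaB_unique`, U2 `ZetaA_unique_upto_mu` become
UNCONDITIONAL theorems about every §4 setting `S : BiKummerSetting X T D (treeCatVocab D _ _)` and every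
transport `pullFrac`; L04 `RootSquares`, L07′ `RootUnitTorsion`, L07 `ZetaB`, L02 `RootFractionPair` hold
modulo the birational DICTIONARY (`toB`, `hfrac`, `hpull`: "`O^×(A^birat)` embeds in `B(A^bs)`",
[FrdI] Thm. 5.2 (ii) — `rfl`-level at the model, cf. `rootSquares_mkOfModel`, `rootFractionPair_mkOfModel`)
and the disjoint-support laws only; L06 `ZetaA` / L05 `UnitRootsUpstairs` modulo the §4 inputs `hE`
(Def. 4.1 (iv) ⇒ [FrdI] Def. 2.7 base-Frobenius pairs) and `hL` («roots of constants», GAP-LEDGER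
G-w4d044-1) only; L01b `SaturatedRefinement` modulo `hE`/`hS` (GAP-LEDGER G-w4d044-2, Galois-surjection
naturality) and the transport dictionary only; and the typed node `Prop42_iv` modulo `ZetaA` + dictionary.
Every proof is a one-line specialisation of the theorem of record; nothing of [EtTh] is re-typed, no `def`,
no new hypothesis.  HONEST FRAMING: refereed pre-IUT material ([EtTh] 2009); typed ≠ proved for the rows
that keep named inputs; nothing here bears on or takes a side on [IUTchIII] Cor. 3.12.
-/

namespace Literature.AnabelianGeometry.EtaleTheta

open CategoryTheory Opposite Literature.AlgebraicGeometry.Frobenioids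

universe u₀ v₀ u v w

variable {K : Type u₀} [Field K]

namespace BiKummerSetting

namespace Prop42Sub

/-! ## §A. Arbitrary [FrdI]-vocabulary `VD`: the group-likeness law `hBg` discharged -/

section General

variable {X : SemiGraphs.TemperedArithmeticGroup.{u₀} K} {D₀ : Type u₀} [Category.{v₀} D₀]
  {V : FrdIMonoidStub.{w}} {T : RealifiedDivisorMonoids (D₀ := D₀) V} {D : Type u} [Category.{v} D]
  {VD : FrdICatStub.{u, v, w} D} (S : BiKummerSetting X T D VD)
  (pullFrac : ∀ {A A' : S.C} (_ : A' ⟶ A), S.biratUnits A → S.biratUnits A')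

/-- **(iv)/L08 `BetaCompat`** modulo divisoriality of `Φ` only (`hBg` discharged by
`ratFnFunctor_isGroupLike_holds`). [cite: MochizukiEtTh2009, Prop 4.2 p.89] -/
theorem betaCompat_of_isDivisorial (hΦd : Objectwise (fun M _ => IsDivisorial M) S.tf.divisorMonoid) :
    BetaCompat S pullFrac :=
  betaCompat_of S pullFrac hΦd S.tf.ratFnFunctor_isGroupLike_holds

/-- **(iv)/U1 `ZetaB_unique`** modulo divisoriality of `Φ` only. [cite: MochizukiEtTh2009, Prop 4.2 p.89] -/
theorem zetaB_unique_of_isDivisorial (hΦd : Objectwise (fun M _ => IsDivisorial M) S.tf.divisorMonoid) :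
    ZetaB_unique S pullFrac :=
  zetaB_unique_of S pullFrac hΦd S.tf.ratFnFunctor_isGroupLike_holds

/-- **(iv)/U2 `ZetaA_unique_upto_mu`** modulo divisoriality of `Φ` only.
[cite: MochizukiEtTh2009, Prop 4.2 p.89] -/
theorem zetaA_unique_upto_mu_of_isDivisorial
    (hΦd : Objectwise (fun M _ => IsDivisorial M) S.tf.divisorMonoid) :
    ZetaA_unique_upto_mu S pullFrac :=
  zetaA_unique_upto_mu_of S pullFrac hΦd S.tf.ratFnFunctor_isGroupLike_holds

/-- **(iv)/L07 `ZetaB`** modulo divisoriality of `Φ` and the `μ_N`-clause L07′ only.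
[cite: MochizukiEtTh2009, Prop 4.2 p.90] -/
theorem zetaB_of_isDivisorial (hΦd : Objectwise (fun M _ => IsDivisorial M) S.tf.divisorMonoid)
    (hμ : RootUnitTorsion S pullFrac) : ZetaB S pullFrac :=
  zetaB_of S pullFrac hΦd S.tf.ratFnFunctor_isGroupLike_holds hμ

/-- **(iv)/L07′ `RootUnitTorsion`** modulo divisoriality of `Φ` and the birational dictionary
(`toB`, `hfrac`, `hpull`) only. [cite: MochizukiEtTh2009, Prop 4.2 p.89] -/
theorem rootUnitTorsion_of_isDivisorial
    (hΦd : Objectwise (fun M _ => IsDivisorial M) S.tf.divisorMonoid)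
    (toB : ∀ A : S.C, S.biratUnits A →* (S.tf.ratFnFunctor.obj (op A.base))ˣ)
    (hfrac : ∀ {A B : S.C} (s' s'' : A ⟶ B) (h' : S.IsPreStep s') (h'' : S.IsPreStep s'')
      (hb : PreFrobenioid.BaseEquivalent S.F s' s''),
      (toB A (S.fracOf s' s'' h' h'' hb) : S.tf.ratFnFunctor.obj (op A.base)) *
        ModelFrobenioid.unit s'' = ModelFrobenioid.unit s')
    (hpull : ∀ {A A' : S.C} (φ : A' ⟶ A) (x : S.biratUnits A),
      (toB A' (pullFrac φ x) : S.tf.ratFnFunctor.obj (op A'.base)) =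
        pull S.tf.ratFnFunctor (ModelFrobenioid.baseMap φ) (toB A x)) :
    RootUnitTorsion S pullFrac :=
  rootUnitTorsion_of S pullFrac hΦd S.tf.ratFnFunctor_isGroupLike_holds toB hfrac hpull

/-- **(iii)/L04 `RootSquares`** modulo the birational dictionary only — NO structural law left.
[cite: MochizukiEtTh2009, Prop 4.2 p.90] -/
theorem rootSquares_of_dictionary
    (toB : ∀ A : S.C, S.biratUnits A →* (S.tf.ratFnFunctor.obj (op A.base))ˣ)
    (hfrac : ∀ {A B : S.C} (s' s'' : A ⟶ B) (h' : S.IsPreStep s') (h'' : S.IsPreStep s'')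
      (hb : PreFrobenioid.BaseEquivalent S.F s' s''),
      (toB A (S.fracOf s' s'' h' h'' hb) : S.tf.ratFnFunctor.obj (op A.base)) *
        ModelFrobenioid.unit s'' = ModelFrobenioid.unit s')
    (hpull : ∀ {A A' : S.C} (φ : A' ⟶ A) (x : S.biratUnits A),
      (toB A' (pullFrac φ x) : S.tf.ratFnFunctor.obj (op A'.base)) =
        pull S.tf.ratFnFunctor (ModelFrobenioid.baseMap φ) (toB A x)) :
    RootSquares S pullFrac :=
  rootSquares_of S pullFrac S.tf.ratFnFunctor_isGroupLike_holds toB hfrac hpull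

/-- **(iv)/L06 `ZetaA`** modulo divisoriality of `Φ`, the base-Frobenius-pair input `hE` (Def. 4.1 (iv) ⇒
[FrdI] Def. 2.7) and L05 only. [cite: MochizukiEtTh2009, Prop 4.2 p.90] -/
theorem zetaA_of_unitRootsUpstairs_of_isDivisorial
    (hΦd : Objectwise (fun M _ => IsDivisorial M) S.tf.divisorMonoid)
    (hE : ∀ {A B : S.C} (G : Subgroup (Aut A)) (α₂ : A ⟶ A) (α₁ : A ⟶ B),
      S.ArisesFromBaseFrobeniusPair G α₂ α₁ → S.tf.ArisesFromBaseFrobeniusPair G α₂ α₁)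
    (h₅ : UnitRootsUpstairs S pullFrac) : ZetaA S pullFrac :=
  zetaA_of_unitRootsUpstairs S pullFrac hΦd S.tf.ratFnFunctor_isGroupLike_holds hE h₅

/-- **(iv)/L05 `UnitRootsUpstairs`** modulo divisoriality of `Φ` and the «roots of constants» law `hL`
(GAP-LEDGER G-w4d044-1) only. [cite: MochizukiEtTh2009, Prop 4.2 p.90] -/
theorem unitRootsUpstairs_of_constantRoots_of_isDivisorial
    (hΦd : Objectwise (fun M _ => IsDivisorial M) S.tf.divisorMonoid)
    (hL : ∀ (A'' : S.C) (N : ℕ+) (g : A''.base ⟶ S.Aodot.base)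
      (ξ : S.tf.ratFnFunctor.obj (op S.Aodot.base)),
      S.IsFrobeniusTrivial A'' → S.IsNHSaturatedBsFld S.HodotBsFld A'' N →
      divB S.tf.divisorMonoid S.tf.ratFnFunctor S.tf.divBNatTrans (op S.Aodot.base) ξ = 1 →
        ∃ ζ : S.tf.ratFnFunctor.obj (op A''.base), ζ ^ (N : ℕ) = pull S.tf.ratFnFunctor g ξ) :
    UnitRootsUpstairs S pullFrac :=
  unitRootsUpstairs_of_constantRoots S pullFrac hΦd S.tf.ratFnFunctor_isGroupLike_holds hL

/-- **(iv)/L06 `ZetaA`** modulo divisoriality of `Φ`, `hE` and `hL` only.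
[cite: MochizukiEtTh2009, Prop 4.2 p.90] -/
theorem zetaA_of_constantRoots_of_isDivisorial
    (hΦd : Objectwise (fun M _ => IsDivisorial M) S.tf.divisorMonoid)
    (hE : ∀ {A B : S.C} (G : Subgroup (Aut A)) (α₂ : A ⟶ A) (α₁ : A ⟶ B),
      S.ArisesFromBaseFrobeniusPair G α₂ α₁ → S.tf.ArisesFromBaseFrobeniusPair G α₂ α₁)
    (hL : ∀ (A'' : S.C) (N : ℕ+) (g : A''.base ⟶ S.Aodot.base)
      (ξ : S.tf.ratFnFunctor.obj (op S.Aodot.base)),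
      S.IsFrobeniusTrivial A'' → S.IsNHSaturatedBsFld S.HodotBsFld A'' N →
      divB S.tf.divisorMonoid S.tf.ratFnFunctor S.tf.divBNatTrans (op S.Aodot.base) ξ = 1 →
        ∃ ζ : S.tf.ratFnFunctor.obj (op A''.base), ζ ^ (N : ℕ) = pull S.tf.ratFnFunctor g ξ) :
    ZetaA S pullFrac :=
  zetaA_of_constantRoots S pullFrac hΦd S.tf.ratFnFunctor_isGroupLike_holds hE hL

/-- **The typed node `Prop42_iv`** modulo divisoriality of `Φ`, the birational dictionary and L06 `ZetaA`
only. [cite: MochizukiEtTh2009, Prop 4.2 p.89] -/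
theorem prop42_iv_of_zetaA_of_isDivisorial
    (hΦd : Objectwise (fun M _ => IsDivisorial M) S.tf.divisorMonoid)
    (toB : ∀ A : S.C, S.biratUnits A →* (S.tf.ratFnFunctor.obj (op A.base))ˣ)
    (hfrac : ∀ {A B : S.C} (s' s'' : A ⟶ B) (h' : S.IsPreStep s') (h'' : S.IsPreStep s'')
      (hb : PreFrobenioid.BaseEquivalent S.F s' s''),
      (toB A (S.fracOf s' s'' h' h'' hb) : S.tf.ratFnFunctor.obj (op A.base)) *
        ModelFrobenioid.unit s'' = ModelFrobenioid.unit s')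
    (hpull : ∀ {A A' : S.C} (φ : A' ⟶ A) (x : S.biratUnits A),
      (toB A' (pullFrac φ x) : S.tf.ratFnFunctor.obj (op A'.base)) =
        pull S.tf.ratFnFunctor (ModelFrobenioid.baseMap φ) (toB A x))
    (h₆ : ZetaA S pullFrac) : S.Prop42_iv pullFrac :=
  prop42_iv_of_zetaA S pullFrac hΦd S.tf.ratFnFunctor_isGroupLike_holds toB hfrac hpull h₆

/-- **The typed node `Prop42_iv`** modulo divisoriality of `Φ`, the dictionary, `hE` and L05 only.
[cite: MochizukiEtTh2009, Prop 4.2 p.89] -/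
theorem prop42_iv_of_unitRootsUpstairs_of_isDivisorial
    (hΦd : Objectwise (fun M _ => IsDivisorial M) S.tf.divisorMonoid)
    (toB : ∀ A : S.C, S.biratUnits A →* (S.tf.ratFnFunctor.obj (op A.base))ˣ)
    (hfrac : ∀ {A B : S.C} (s' s'' : A ⟶ B) (h' : S.IsPreStep s') (h'' : S.IsPreStep s'')
      (hb : PreFrobenioid.BaseEquivalent S.F s' s''),
      (toB A (S.fracOf s' s'' h' h'' hb) : S.tf.ratFnFunctor.obj (op A.base)) *
        ModelFrobenioid.unit s'' = ModelFrobenioid.unit s')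
    (hpull : ∀ {A A' : S.C} (φ : A' ⟶ A) (x : S.biratUnits A),
      (toB A' (pullFrac φ x) : S.tf.ratFnFunctor.obj (op A'.base)) =
        pull S.tf.ratFnFunctor (ModelFrobenioid.baseMap φ) (toB A x))
    (hE : ∀ {A B : S.C} (G : Subgroup (Aut A)) (α₂ : A ⟶ A) (α₁ : A ⟶ B),
      S.ArisesFromBaseFrobeniusPair G α₂ α₁ → S.tf.ArisesFromBaseFrobeniusPair G α₂ α₁)
    (h₅ : UnitRootsUpstairs S pullFrac) : S.Prop42_iv pullFrac :=
  prop42_iv_of_unitRootsUpstairs S pullFrac hΦd S.tf.ratFnFunctor_isGroupLike_holds toB hfrac hpull hE h₅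

/-- **(iii)/L01b `SaturatedRefinement`** modulo divisoriality of `Φ`, the saturation/naturality inputs
`hE`, `hS` (GAP-LEDGER G-w4d044-2) and the transport dictionary `hpow`/`hcomp`/`hfix` only.
[cite: MochizukiEtTh2009, Prop 4.2 p.90] -/
theorem saturatedRefinement_of_laws_of_isDivisorial
    (hΦd : Objectwise (fun M _ => IsDivisorial M) S.tf.divisorMonoid)
    (hE : ∀ (N : ℕ+) (A' : S.C), S.IsFrobeniusTrivial A' → S.IsGalois A' →
      ∃ (A'' : S.C) (ψ : A'' ⟶ A'), S.IsPullback ψ ∧ S.IsGalois A'' ∧ S.IsMuSaturated A'' N ∧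
        S.IsNHSaturatedBsFld S.HodotBsFld A'' N)
    (hS : ∀ ⦃A B : D⦄ (hA : S.IsGaloisObj A) (hB : S.IsGaloisObj B) (b : B ⟶ A),
      ∃ c : X.Pi, ∀ g : X.Pi, (S.galoisSurj B hB g).hom ≫ b = b ≫ (S.galoisSurj A hA (c * g * c⁻¹)).hom)
    (hpow : ∀ {A B : S.C} (φ : A ⟶ B) (x : S.biratUnits B) (n : ℕ), pullFrac φ (x ^ n) = pullFrac φ x ^ n)
    (hcomp : ∀ {A B E : S.C} (ψ : A ⟶ B) (φ : B ⟶ E) (x : S.biratUnits E),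
      pullFrac (ψ ≫ φ) x = pullFrac ψ (pullFrac φ x))
    (hfix : ∀ {A : S.C} (σ : Aut A) (b : A ⟶ S.Aodot) (x : S.biratUnits S.Aodot),
      ModelFrobenioid.baseMap σ.hom ≫ ModelFrobenioid.baseMap b = ModelFrobenioid.baseMap b →
        S.biratAut A σ (pullFrac b x) = pullFrac b x) :
    SaturatedRefinement S pullFrac :=
  saturatedRefinement_of_laws S pullFrac hΦd S.tf.ratFnFunctor_isGroupLike_holds hE hS hpow hcomp hfix

end General

/-! ## §B. The canonical vocabulary `treeCatVocab`: both structural laws discharged -/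

section TreeVocab

variable {X : SemiGraphs.TemperedArithmeticGroup.{u₀} K} {D₀ : Type u₀} [Category.{v₀} D₀]
  {V : FrdIMonoidStub.{w}} {T : RealifiedDivisorMonoids (D₀ := D₀) V} {D : Type u} [Category.{v} D]
  {IsRational IsStrictlyRational : (Dᵒᵖ ⥤ CommMonCat.{w}) → Prop}
  (S : BiKummerSetting X T D (treeCatVocab D IsRational IsStrictlyRational))
  (pullFrac : ∀ {A A' : S.C} (_ : A' ⟶ A), S.biratUnits A → S.biratUnits A')

/-- **(iv)/L08 `BetaCompat` — UNCONDITIONAL at the canonical [FrdI] vocabulary**: «`β = β̄ ∘ ζ_B`» holds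
for every §4 setting and every transport of birational units. [cite: MochizukiEtTh2009, Prop 4.2 p.89] -/
theorem betaCompat_treeCatVocab : BetaCompat S pullFrac :=
  betaCompat_of_isDivisorial S pullFrac S.tf.isDivisorial_divisorMonoid

/-- **(iv)/U1 `ZetaB_unique` — UNCONDITIONAL at the canonical vocabulary**: «`ζ_B` is uniquely determined
by `ζ_A`». [cite: MochizukiEtTh2009, Prop 4.2 p.89] -/
theorem zetaB_unique_treeCatVocab : ZetaB_unique S pullFrac :=
  zetaB_unique_of_isDivisorial S pullFrac S.tf.isDivisorial_divisorMonoid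

/-- **(iv)/U2 `ZetaA_unique_upto_mu` — UNCONDITIONAL at the canonical vocabulary**: «`ζ_A` is uniquely
determined by `Ā'`, up to composition with an element of `μ_N(A_N)`».
[cite: MochizukiEtTh2009, Prop 4.2 p.89] -/
theorem zetaA_unique_upto_mu_treeCatVocab : ZetaA_unique_upto_mu S pullFrac :=
  zetaA_unique_upto_mu_of_isDivisorial S pullFrac S.tf.isDivisorial_divisorMonoid

/-- **(iv)/L07 `ZetaB`** at the canonical vocabulary modulo the `μ_N`-clause L07′ only.
[cite: MochizukiEtTh2009, Prop 4.2 p.90] -/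
theorem zetaB_treeCatVocab_of_rootUnitTorsion (hμ : RootUnitTorsion S pullFrac) : ZetaB S pullFrac :=
  zetaB_of_isDivisorial S pullFrac S.tf.isDivisorial_divisorMonoid hμ

/-- **(iv)/L07′ `RootUnitTorsion`** at the canonical vocabulary modulo the birational dictionary only.
[cite: MochizukiEtTh2009, Prop 4.2 p.89] -/
theorem rootUnitTorsion_treeCatVocab_of_dictionary
    (toB : ∀ A : S.C, S.biratUnits A →* (S.tf.ratFnFunctor.obj (op A.base))ˣ)
    (hfrac : ∀ {A B : S.C} (s' s'' : A ⟶ B) (h' : S.IsPreStep s') (h'' : S.IsPreStep s'')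
      (hb : PreFrobenioid.BaseEquivalent S.F s' s''),
      (toB A (S.fracOf s' s'' h' h'' hb) : S.tf.ratFnFunctor.obj (op A.base)) *
        ModelFrobenioid.unit s'' = ModelFrobenioid.unit s')
    (hpull : ∀ {A A' : S.C} (φ : A' ⟶ A) (x : S.biratUnits A),
      (toB A' (pullFrac φ x) : S.tf.ratFnFunctor.obj (op A'.base)) =
        pull S.tf.ratFnFunctor (ModelFrobenioid.baseMap φ) (toB A x)) :
    RootUnitTorsion S pullFrac :=
  rootUnitTorsion_of_isDivisorial S pullFrac S.tf.isDivisorial_divisorMonoid toB hfrac hpull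

/-- **(iv)/L07 `ZetaB`** at the canonical vocabulary modulo the birational dictionary only.
[cite: MochizukiEtTh2009, Prop 4.2 p.90] -/
theorem zetaB_treeCatVocab_of_dictionary
    (toB : ∀ A : S.C, S.biratUnits A →* (S.tf.ratFnFunctor.obj (op A.base))ˣ)
    (hfrac : ∀ {A B : S.C} (s' s'' : A ⟶ B) (h' : S.IsPreStep s') (h'' : S.IsPreStep s'')
      (hb : PreFrobenioid.BaseEquivalent S.F s' s''),
      (toB A (S.fracOf s' s'' h' h'' hb) : S.tf.ratFnFunctor.obj (op A.base)) *
        ModelFrobenioid.unit s'' = ModelFrobenioid.unit s')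
    (hpull : ∀ {A A' : S.C} (φ : A' ⟶ A) (x : S.biratUnits A),
      (toB A' (pullFrac φ x) : S.tf.ratFnFunctor.obj (op A'.base)) =
        pull S.tf.ratFnFunctor (ModelFrobenioid.baseMap φ) (toB A x)) :
    ZetaB S pullFrac :=
  zetaB_treeCatVocab_of_rootUnitTorsion S pullFrac
    (rootUnitTorsion_treeCatVocab_of_dictionary S pullFrac toB hfrac hpull)

/-- **(iv)/L05 `UnitRootsUpstairs`** at the canonical vocabulary modulo the «roots of constants» law `hL`
(GAP-LEDGER G-w4d044-1) only. [cite: MochizukiEtTh2009, Prop 4.2 p.90] -/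
theorem unitRootsUpstairs_treeCatVocab_of_constantRoots
    (hL : ∀ (A'' : S.C) (N : ℕ+) (g : A''.base ⟶ S.Aodot.base)
      (ξ : S.tf.ratFnFunctor.obj (op S.Aodot.base)),
      S.IsFrobeniusTrivial A'' → S.IsNHSaturatedBsFld S.HodotBsFld A'' N →
      divB S.tf.divisorMonoid S.tf.ratFnFunctor S.tf.divBNatTrans (op S.Aodot.base) ξ = 1 →
        ∃ ζ : S.tf.ratFnFunctor.obj (op A''.base), ζ ^ (N : ℕ) = pull S.tf.ratFnFunctor g ξ) :
    UnitRootsUpstairs S pullFrac :=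
  unitRootsUpstairs_of_constantRoots_of_isDivisorial S pullFrac S.tf.isDivisorial_divisorMonoid hL

/-- **(iv)/L06 `ZetaA`** at the canonical vocabulary modulo `hE` (Def. 4.1 (iv) ⇒ [FrdI] Def. 2.7) and L05
only. [cite: MochizukiEtTh2009, Prop 4.2 p.90] -/
theorem zetaA_treeCatVocab_of_unitRootsUpstairs
    (hE : ∀ {A B : S.C} (G : Subgroup (Aut A)) (α₂ : A ⟶ A) (α₁ : A ⟶ B),
      S.ArisesFromBaseFrobeniusPair G α₂ α₁ → S.tf.ArisesFromBaseFrobeniusPair G α₂ α₁)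
    (h₅ : UnitRootsUpstairs S pullFrac) : ZetaA S pullFrac :=
  zetaA_of_unitRootsUpstairs_of_isDivisorial S pullFrac S.tf.isDivisorial_divisorMonoid hE h₅

/-- **(iv)/L06 `ZetaA`** at the canonical vocabulary modulo `hE` and `hL` only.
[cite: MochizukiEtTh2009, Prop 4.2 p.90] -/
theorem zetaA_treeCatVocab_of_constantRoots
    (hE : ∀ {A B : S.C} (G : Subgroup (Aut A)) (α₂ : A ⟶ A) (α₁ : A ⟶ B),
      S.ArisesFromBaseFrobeniusPair G α₂ α₁ → S.tf.ArisesFromBaseFrobeniusPair G α₂ α₁)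
    (hL : ∀ (A'' : S.C) (N : ℕ+) (g : A''.base ⟶ S.Aodot.base)
      (ξ : S.tf.ratFnFunctor.obj (op S.Aodot.base)),
      S.IsFrobeniusTrivial A'' → S.IsNHSaturatedBsFld S.HodotBsFld A'' N →
      divB S.tf.divisorMonoid S.tf.ratFnFunctor S.tf.divBNatTrans (op S.Aodot.base) ξ = 1 →
        ∃ ζ : S.tf.ratFnFunctor.obj (op A''.base), ζ ^ (N : ℕ) = pull S.tf.ratFnFunctor g ξ) :
    ZetaA S pullFrac :=
  zetaA_of_constantRoots_of_isDivisorial S pullFrac S.tf.isDivisorial_divisorMonoid hE hL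

/-- **The typed node `Prop42_iv`** at the canonical vocabulary modulo the birational dictionary and L06
`ZetaA` only. [cite: MochizukiEtTh2009, Prop 4.2 p.89] -/
theorem prop42_iv_treeCatVocab_of_zetaA
    (toB : ∀ A : S.C, S.biratUnits A →* (S.tf.ratFnFunctor.obj (op A.base))ˣ)
    (hfrac : ∀ {A B : S.C} (s' s'' : A ⟶ B) (h' : S.IsPreStep s') (h'' : S.IsPreStep s'')
      (hb : PreFrobenioid.BaseEquivalent S.F s' s''),
      (toB A (S.fracOf s' s'' h' h'' hb) : S.tf.ratFnFunctor.obj (op A.base)) *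
        ModelFrobenioid.unit s'' = ModelFrobenioid.unit s')
    (hpull : ∀ {A A' : S.C} (φ : A' ⟶ A) (x : S.biratUnits A),
      (toB A' (pullFrac φ x) : S.tf.ratFnFunctor.obj (op A'.base)) =
        pull S.tf.ratFnFunctor (ModelFrobenioid.baseMap φ) (toB A x))
    (h₆ : ZetaA S pullFrac) : S.Prop42_iv pullFrac :=
  prop42_iv_of_zetaA_of_isDivisorial S pullFrac S.tf.isDivisorial_divisorMonoid toB hfrac hpull h₆

/-- **The typed node `Prop42_iv`** at the canonical vocabulary modulo the dictionary, `hE` and the «roots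
of constants» law `hL` only — the print's two §4-external inputs. [cite: MochizukiEtTh2009, Prop 4.2 p.89] -/
theorem prop42_iv_treeCatVocab_of_constantRoots
    (toB : ∀ A : S.C, S.biratUnits A →* (S.tf.ratFnFunctor.obj (op A.base))ˣ)
    (hfrac : ∀ {A B : S.C} (s' s'' : A ⟶ B) (h' : S.IsPreStep s') (h'' : S.IsPreStep s'')
      (hb : PreFrobenioid.BaseEquivalent S.F s' s''),
      (toB A (S.fracOf s' s'' h' h'' hb) : S.tf.ratFnFunctor.obj (op A.base)) *
        ModelFrobenioid.unit s'' = ModelFrobenioid.unit s')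
    (hpull : ∀ {A A' : S.C} (φ : A' ⟶ A) (x : S.biratUnits A),
      (toB A' (pullFrac φ x) : S.tf.ratFnFunctor.obj (op A'.base)) =
        pull S.tf.ratFnFunctor (ModelFrobenioid.baseMap φ) (toB A x))
    (hE : ∀ {A B : S.C} (G : Subgroup (Aut A)) (α₂ : A ⟶ A) (α₁ : A ⟶ B),
      S.ArisesFromBaseFrobeniusPair G α₂ α₁ → S.tf.ArisesFromBaseFrobeniusPair G α₂ α₁)
    (hL : ∀ (A'' : S.C) (N : ℕ+) (g : A''.base ⟶ S.Aodot.base)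
      (ξ : S.tf.ratFnFunctor.obj (op S.Aodot.base)),
      S.IsFrobeniusTrivial A'' → S.IsNHSaturatedBsFld S.HodotBsFld A'' N →
      divB S.tf.divisorMonoid S.tf.ratFnFunctor S.tf.divBNatTrans (op S.Aodot.base) ξ = 1 →
        ∃ ζ : S.tf.ratFnFunctor.obj (op A''.base), ζ ^ (N : ℕ) = pull S.tf.ratFnFunctor g ξ) :
    S.Prop42_iv pullFrac :=
  prop42_iv_treeCatVocab_of_zetaA S pullFrac toB hfrac hpull
    (zetaA_treeCatVocab_of_constantRoots S pullFrac hE hL)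

/-- **(iii)/L02 `RootFractionPair`** at the canonical vocabulary modulo the birational dictionary
(`toB` injective, `hfrac`, `hpull`) and the two disjoint-support laws only.
[cite: MochizukiEtTh2009, Prop 4.2 p.89] -/
theorem rootFractionPair_treeCatVocab_of_dictionary
    (toB : ∀ A : S.C, S.biratUnits A →* (S.tf.ratFnFunctor.obj (op A.base))ˣ)
    (htoB : ∀ A : S.C, Function.Injective (toB A))
    (hfrac : ∀ {A B : S.C} (s' s'' : A ⟶ B) (h' : S.IsPreStep s') (h'' : S.IsPreStep s'')
      (hb : PreFrobenioid.BaseEquivalent S.F s' s''),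
      (toB A (S.fracOf s' s'' h' h'' hb) : S.tf.ratFnFunctor.obj (op A.base)) *
        ModelFrobenioid.unit s'' = ModelFrobenioid.unit s')
    (hpull : ∀ {A A' : S.C} (φ : A' ⟶ A) (x : S.biratUnits A),
      (toB A' (pullFrac φ x) : S.tf.ratFnFunctor.obj (op A'.base)) =
        pull S.tf.ratFnFunctor (ModelFrobenioid.baseMap φ) (toB A x))
    (hDSroot : ∀ {A : Dᵒᵖ} {a b : S.tf.Φ.carrier A} (N : ℕ+),
      S.DisjointSupports (a ^ (N : ℕ)) (b ^ (N : ℕ)) → S.DisjointSupports a b)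
    (hDSpull : ∀ {A A' : D} (e : A' ⟶ A) {a b : S.tf.Φ.carrier (op A)}, S.DisjointSupports a b →
      S.DisjointSupports (pull S.tf.divisorMonoid e a) (pull S.tf.divisorMonoid e b)) :
    RootFractionPair S pullFrac :=
  rootFractionPair_of S pullFrac S.tf.isDivisorial_divisorMonoid toB htoB hfrac hpull hDSroot hDSpull

/-- **(iii)/L01b `SaturatedRefinement`** at the canonical vocabulary modulo `hE`/`hS` (GAP-LEDGER
G-w4d044-2; Galois-surjection naturality) and the transport dictionary only.
[cite: MochizukiEtTh2009, Prop 4.2 p.90] -/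
theorem saturatedRefinement_treeCatVocab_of_laws
    (hE : ∀ (N : ℕ+) (A' : S.C), S.IsFrobeniusTrivial A' → S.IsGalois A' →
      ∃ (A'' : S.C) (ψ : A'' ⟶ A'), S.IsPullback ψ ∧ S.IsGalois A'' ∧ S.IsMuSaturated A'' N ∧
        S.IsNHSaturatedBsFld S.HodotBsFld A'' N)
    (hS : ∀ ⦃A B : D⦄ (hA : S.IsGaloisObj A) (hB : S.IsGaloisObj B) (b : B ⟶ A),
      ∃ c : X.Pi, ∀ g : X.Pi, (S.galoisSurj B hB g).hom ≫ b = b ≫ (S.galoisSurj A hA (c * g * c⁻¹)).hom)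
    (hpow : ∀ {A B : S.C} (φ : A ⟶ B) (x : S.biratUnits B) (n : ℕ), pullFrac φ (x ^ n) = pullFrac φ x ^ n)
    (hcomp : ∀ {A B E : S.C} (ψ : A ⟶ B) (φ : B ⟶ E) (x : S.biratUnits E),
      pullFrac (ψ ≫ φ) x = pullFrac ψ (pullFrac φ x))
    (hfix : ∀ {A : S.C} (σ : Aut A) (b : A ⟶ S.Aodot) (x : S.biratUnits S.Aodot),
      ModelFrobenioid.baseMap σ.hom ≫ ModelFrobenioid.baseMap b = ModelFrobenioid.baseMap b →
        S.biratAut A σ (pullFrac b x) = pullFrac b x) :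
    SaturatedRefinement S pullFrac :=
  saturatedRefinement_of_laws_of_isDivisorial S pullFrac S.tf.isDivisorial_divisorMonoid
    hE hS hpow hcomp hfix

end TreeVocab

end Prop42Sub

end BiKummerSetting

end Literature.AnabelianGeometry.EtaleTheta
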